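import Mathlib
import Summits.HodgeConjecture.FermatCycles.HodgeFermatTheoremU

/-!
# LEMMA W from HYPOTHESIS B — the Fourier-analytic half of LEMMA W (`HodgeFermat/LemmaWFourier.lean`; HF-G22d)

Tree copy (whole module) of the module `HodgeFermat/LemmaWFourier.lean` of the sibling cell's standalone package
`run/shared/lean/pub/pub-hodgefermat/lean/HodgeFermat/` (346 lines, sha256 `bf220c417ca5661d…`), source lines 55–346 (all: `charMoment`, `badSet`, `badCount`, `HypB`, the character transform `hat`, inversion, the pointwise bound, `lemmaW_of_badCount`, `hypW_of_B`, `thmU_of_B`, `theoremD6_of_B`).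
Filed by cell `pub-hfermat`, seat prover-1 gen-3, on the COORDINATOR KEEPER RULING of 2026-08-25 (gem sweep H1: take the
off-gate kernel theorem `thmFstar` through the gate) — here THEOREM F* of `tables/DPRIME-THEOREM.md` §9 IN FULL, i.e.
PROPOSITION D′(3N) and the descent (`HodgeFermat/PropDPrimeNFinal.lean`, GATE HF-G34), the last off-gate form of THEOREM F*
(its first two forms, `DecodingFinal.thmFstar` = F* at the prime levels and `ThmFstarNFinal.thmFstar` = F*(3N), landed on
2026-08-25 as `HodgeFermatThmFstar.lean` / `HodgeFermatThmFstarN.lean`, seats prover-1 gen-0 / gen-2); this file is one link of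
the import closure of `PropDPrimeNFinal.propDprime` (the sibling's KR-free chain: THEOREM L, COROLLARY M, THEOREM D6,
THEOREM U⁺, THEOREM KR6, THEOREM Z3U) on top of those landed chains.  The source module is the sibling's hub-checked module of
record (pub-hodgefermat `CERT.md` l.891, GATE HF-G22d; cell record `check/LemmaWFourier_standalone.lean` sha256 `51bed92f03ebd76c…`); its declarations are copied VERBATIM.
Deviations from the source module, exhaustively: the `import` lines (tree modules `Summits.HodgeConjecture.FermatCycles.
HodgeFermat*` instead of `HodgeFermat.*`); this module docstring; one-line docstrings added (gate lint) to `badCount_eq`, `sum_range_eq_sum_zmod`, `hypW_of_B` (this module's `hat`/`inversion`/`norm_hat_le` are over ITS OWN `hat`; the later copies in `BadVanish.lean` have their own `hat` and are different declarations).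
Every other line — in particular every declaration's statement and proof — is byte-identical to the source.
HONEST FRAMING: explicit algebraic cycles for specific Hodge classes on Fermat/Delsarte varieties; residual open instances
listed; no claim on general Hodge.  (This file is arithmetic of CM types / finite combinatorics / analytic number theory
of the sibling's KR-free programme; it claims nothing about cycles.)

The source module's docstring (LemmaWFourier.lean l.6–53), verbatim:

## LEMMA W from HYPOTHESIS B — the Fourier-analytic half of LEMMA W in the kernel (HF-G22d)

`HodgeFermat/TheoremU.lean` derives THEOREM U and THEOREM D6 from LEMMA W (`LemmaW N`: at level `N`, an odd
integer weight on the units of `ℤ/N` with at most 12-point support whose residue transform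
`t ↦ Σ_x w(x) ⟨t x⟩_N` vanishes at every unit is zero).  This file proves, by finite Fourier analysis on `(ℤ/N)ˣ`
(Mathlib's Dirichlet characters and their orthogonality relations), that `LemmaW N` follows from the COUNTING
hypothesis

  `12 · #bad(N) < φ(N)`,  where an odd Dirichlet character `χ` mod `N` (values in `ℂ`) is BAD when its first moment
  `S(χ) = Σ_{v ∈ (ℤ/N)ˣ} χ(v⁻¹) · v` (representatives `v ∈ [1, N)`) vanishes

(`charMoment`, `badSet`, `badCount`, `lemmaW_of_badCount`), and hence THEOREM U and THEOREM D6 from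

  `HypB : ∀ N, 1 < N → Squarefree N → ¬ 2 ∣ N → ¬ 3 ∣ N → 12 * badCount N < N.totient`

(`hypW_of_B : HypB → HypW`, `thmU_of_B : HypB → ThmU`, `theoremD6_of_B : HypB → D6`).

## The argument (= `tables/SEMI-THEOREM.md` §2, proof of Theorem U / Lemma W, with the uncertainty principle)

Let `f : ℤ/N → ℂ` be the weight (`f(a) = w(a.val)`), odd and supported on at most 12 units, and put
`ŵ(χ) = Σ_a f(a) χ(a)` (`hat`).
* `hat_even`: `ŵ(χ) = 0` for EVEN `χ` (reindex `a ↦ −a`).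
* `moment_mul_hat`: testing the residue transform against `χ(u⁻¹)` and reindexing `u ↦ u a` on the units
  (`sum_units_mul`) gives `Σ_u χ(u⁻¹) Σ_a f(a)⟨u a⟩ = S(χ) · ŵ(χ)`; so a vanishing transform forces `ŵ(χ) = 0`
  whenever `S(χ) ≠ 0` — i.e. `ŵ` is supported on the bad odd characters (`hat_eq_zero_of_not_bad`).
* `inversion`: `Σ_χ χ(b⁻¹) ŵ(χ) = φ(N) f(b)` for a unit `b` (Mathlib's `DirichletCharacter.sum_char_inv_mul_char_eq`,
  which needs enough roots of unity in `ℂ` — automatic).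
* `pointwise_bound`, `core` (the uncertainty principle `#supp f · #supp ŵ ≥ φ(N)` in the form needed): with
  `L = Σ_a ‖f a‖`, `‖ŵ(χ)‖ ≤ L` (`|χ| ≤ 1`), so `φ(N) ‖f(b)‖ ≤ #bad · L` for every `b`; summing over the ≤ 12 points
  of the support, `φ(N) · L ≤ 12 · #bad · L`, and `12 · #bad < φ(N)` forces `L = 0`, i.e. `f = 0`.
* `lemmaW_of_badCount`: transport of the five hypotheses of `LemmaW N` from `w : ℕ → ℤ` to `f` (`ZMod.val`,
  `ZMod.neg_val`, `ZMod.isUnit_iff_coprime`, `ZMod.val_mul`, `Fin.sum_univ_eq_sum_range`) and back.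

## What remains by hand (HYPOTHESIS B)

For `χ` mod `N` induced from the primitive `χ_f` (conductor `f ∣ N`, `N` squarefree),
`S(χ) = N · B_{1, χ̄_f} · Π_{p ∣ N/f} (1 − χ̄_f(p))` (Möbius over the divisors of `N/f`; the Koblitz–Rohrlich lemma,
Compositio Math. 36 (1978), p. 1188), and `B_{1,ψ} = −L(0, ψ) ≠ 0` for odd primitive `ψ`; so the bad odd characters
are exactly those with `χ_f(p) = 1` for some prime `p ∣ N/f` — the definition used in `tables/SEMI-THEOREM.md` §2 —
and LEMMA S there (`s(N) = #bad odd / (φ(N)/2) < 1/6` for squarefree odd `N ∉ {21, 39}`; exact computation for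
`N ≤ 10⁶`, analytic tail beyond) is precisely `12 · #bad(N) < φ(N)`.  The dictionary was cross-checked by exact linear
algebra for every squarefree `N ≤ 215` prime to 6 (`code/gen22/lemmaW_check.py`, `results/gen22/local/lemmaW_check_215.txt`:
the nullity of the odd residue transform — which by `moment_mul_hat`/`inversion` is the number of odd `χ` with
`S(χ) = 0` — equals the number of odd `χ` with some `χ_f(p) = 1`, and `12 · #bad < φ(N)` throughout).

No `sorry`, no `native_decide`; axioms `[propext, Classical.choice, Quot.sound]`.
-/

namespace HodgeFermat.KRFree.LemmaWFourier

open Finset HodgeFermat.KRFree.TheoremU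

/-! ## 1. Bad characters -/

/-- The first moment `S(χ) = Σ_{v ∈ (ℤ/N)ˣ} χ(v⁻¹) · v` (with `v` represented in `[1, N)`); for a `ℂ`-valued
character this is `Σ_v conj(χ(v)) · v`.  By the Koblitz–Rohrlich computation it equals
`N · B_{1, χ̄_f} · Π_{p ∣ N/f} (1 − χ̄_f(p))` for `χ` induced from the primitive `χ_f` (by hand; not used here). -/
noncomputable def charMoment (N : ℕ) [NeZero N] (χ : DirichletCharacter ℂ N) : ℂ :=
  ∑ v : (ZMod N)ˣ, χ ((v⁻¹ : (ZMod N)ˣ) : ZMod N) * (((v : ZMod N).val : ℕ) : ℂ)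

open Classical in
/-- The BAD characters mod `N`: odd, with vanishing first moment. -/
noncomputable def badSet (N : ℕ) [NeZero N] : Finset (DirichletCharacter ℂ N) :=
  Finset.univ.filter (fun χ => χ.Odd ∧ charMoment N χ = 0)

/-- The number of bad odd characters mod `N` (and `0` for `N = 0`). -/
noncomputable def badCount (N : ℕ) : ℕ :=
  if h : N = 0 then 0 else (haveI : NeZero N := ⟨h⟩; (badSet N).card)

/-- `badCount N` is the cardinality of `badSet N` -/
lemma badCount_eq (N : ℕ) [NeZero N] : badCount N = (badSet N).card := by
  unfold badCount
  rw [dif_neg (NeZero.ne N)]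

/-- HYPOTHESIS B: at every squarefree level `N > 1` prime to 6, fewer than `φ(N)/12` odd Dirichlet characters mod `N`
are bad.  (By hand: the bad odd characters are those induced from `χ_f` with `χ_f(p) = 1` for some `p ∣ N/f`, because
`B_{1,ψ} ≠ 0` for odd primitive `ψ`; and their number is `< φ(N)/12` by LEMMA S of `tables/SEMI-THEOREM.md` §2.) -/
def HypB : Prop :=
  ∀ N, 1 < N → Squarefree N → ¬ 2 ∣ N → ¬ 3 ∣ N → 12 * badCount N < N.totient

/-! ## 2. Fourier analysis of an odd weight on `(ℤ/N)ˣ` -/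

section core

variable {N : ℕ} [NeZero N] (f : ZMod N → ℂ)

/-- `ŵ(χ) = Σ_a f(a) χ(a)`. -/
noncomputable def hat (χ : DirichletCharacter ℂ N) : ℂ := ∑ a : ZMod N, f a * χ a

/-- The character transform of an ODD weight vanishes at EVEN characters. -/
lemma hat_even (hodd : ∀ a, f (-a) = - f a) (χ : DirichletCharacter ℂ N) (hχ : χ.Even) : hat f χ = 0 := by
  have h : hat f χ = - hat f χ := by
    calc hat f χ = ∑ a : ZMod N, f (-a) * χ (-a) := by
            unfold hat
            exact Fintype.sum_equiv (Equiv.neg (ZMod N)) _ _ (fun a => by simp)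
      _ = ∑ a : ZMod N, - (f a * χ a) := by
            refine Finset.sum_congr rfl (fun a _ => ?_)
            rw [hodd, DirichletCharacter.Even.eval_neg χ a hχ]; ring
      _ = - hat f χ := by rw [Finset.sum_neg_distrib]; rfl
  have h2 : hat f χ + hat f χ = 0 := by linear_combination h
  exact add_self_eq_zero.mp h2

/-- Reindexing `u ↦ u·a` on the units: `Σ_u χ(u⁻¹) ⟨u a⟩ = χ(a) · S(χ)`. -/
lemma sum_units_mul (χ : DirichletCharacter ℂ N) (a : (ZMod N)ˣ) :
    ∑ u : (ZMod N)ˣ, χ ((u⁻¹ : (ZMod N)ˣ) : ZMod N) * ((((u : ZMod N) * (a : ZMod N)).val : ℕ) : ℂ)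
      = χ (a : ZMod N) * charMoment N χ := by
  unfold charMoment
  rw [Finset.mul_sum]
  refine Fintype.sum_equiv (Equiv.mulRight a) _ _ (fun u => ?_)
  simp only [Equiv.coe_mulRight, Units.val_mul]
  have key : χ (a : ZMod N) * χ (((u * a)⁻¹ : (ZMod N)ˣ) : ZMod N) = χ ((u⁻¹ : (ZMod N)ˣ) : ZMod N) := by
    rw [← map_mul, ← Units.val_mul]
    congr 2
    group
  rw [← mul_assoc, key]

/-- The residue transform tested against `χ(u⁻¹)`: `S(χ) · ŵ(χ) = Σ_u χ(u⁻¹) · (Σ_a f(a) ⟨u a⟩)`; hence a vanishing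
residue transform forces `ŵ(χ) = 0` at every character with `S(χ) ≠ 0`. -/
lemma moment_mul_hat (hunit : ∀ a, ¬ IsUnit a → f a = 0)
    (htr : ∀ u : (ZMod N)ˣ, ∑ a : ZMod N, f a * ((((u : ZMod N) * a).val : ℕ) : ℂ) = 0)
    (χ : DirichletCharacter ℂ N) : charMoment N χ * hat f χ = 0 := by
  have H : ∑ u : (ZMod N)ˣ, χ ((u⁻¹ : (ZMod N)ˣ) : ZMod N) *
      (∑ a : ZMod N, f a * ((((u : ZMod N) * a).val : ℕ) : ℂ)) = 0 := by
    simp only [htr, mul_zero, Finset.sum_const_zero]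
  have inner : ∀ a : ZMod N, f a * ∑ u : (ZMod N)ˣ, χ ((u⁻¹ : (ZMod N)ˣ) : ZMod N) *
      ((((u : ZMod N) * a).val : ℕ) : ℂ) = f a * (χ a * charMoment N χ) := by
    intro a
    by_cases ha : IsUnit a
    · obtain ⟨a', rfl⟩ := ha
      rw [sum_units_mul]
    · rw [hunit a ha, zero_mul, zero_mul]
  calc charMoment N χ * hat f χ
      = ∑ a : ZMod N, f a * (χ a * charMoment N χ) := by
          unfold hat; rw [Finset.mul_sum]; exact Finset.sum_congr rfl (fun a _ => by ring)
    _ = ∑ a : ZMod N, f a * ∑ u : (ZMod N)ˣ, χ ((u⁻¹ : (ZMod N)ˣ) : ZMod N) *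
          ((((u : ZMod N) * a).val : ℕ) : ℂ) := Finset.sum_congr rfl (fun a _ => (inner a).symm)
    _ = ∑ a : ZMod N, ∑ u : (ZMod N)ˣ, χ ((u⁻¹ : (ZMod N)ˣ) : ZMod N) *
          (f a * ((((u : ZMod N) * a).val : ℕ) : ℂ)) := by
          refine Finset.sum_congr rfl (fun a _ => ?_)
          rw [Finset.mul_sum]; exact Finset.sum_congr rfl (fun u _ => by ring)
    _ = ∑ u : (ZMod N)ˣ, ∑ a : ZMod N, χ ((u⁻¹ : (ZMod N)ˣ) : ZMod N) *
          (f a * ((((u : ZMod N) * a).val : ℕ) : ℂ)) := Finset.sum_comm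
    _ = ∑ u : (ZMod N)ˣ, χ ((u⁻¹ : (ZMod N)ˣ) : ZMod N) *
          (∑ a : ZMod N, f a * ((((u : ZMod N) * a).val : ℕ) : ℂ)) := by
          refine Finset.sum_congr rfl (fun u _ => ?_); rw [Finset.mul_sum]
    _ = 0 := H

/-- Off the bad set the character transform of `f` vanishes. -/
lemma hat_eq_zero_of_not_bad (hunit : ∀ a, ¬ IsUnit a → f a = 0) (hodd : ∀ a, f (-a) = - f a)
    (htr : ∀ u : (ZMod N)ˣ, ∑ a : ZMod N, f a * ((((u : ZMod N) * a).val : ℕ) : ℂ) = 0)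
    (χ : DirichletCharacter ℂ N) (hχ : χ ∉ badSet N) : hat f χ = 0 := by
  rcases χ.even_or_odd with he | ho
  · exact hat_even f hodd χ he
  · have hm : charMoment N χ ≠ 0 := by
      intro h0
      apply hχ
      unfold badSet
      simp [ho, h0]
    have := moment_mul_hat f hunit htr χ
    rcases mul_eq_zero.mp this with h | h
    · exact absurd h hm
    · exact h

/-- Fourier inversion on the units: `Σ_χ χ(b⁻¹) ŵ(χ) = φ(N) · f(b)`. -/
lemma inversion (b : (ZMod N)ˣ) :
    ∑ χ : DirichletCharacter ℂ N, χ ((b⁻¹ : (ZMod N)ˣ) : ZMod N) * hat f χ = (N.totient : ℂ) * f b := by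
  have hb : IsUnit (b : ZMod N) := Units.isUnit b
  calc ∑ χ : DirichletCharacter ℂ N, χ ((b⁻¹ : (ZMod N)ˣ) : ZMod N) * hat f χ
      = ∑ χ : DirichletCharacter ℂ N, ∑ a : ZMod N, f a * (χ ((b : ZMod N)⁻¹) * χ a) := by
          refine Finset.sum_congr rfl (fun χ _ => ?_)
          unfold hat
          rw [← ZMod.inv_coe_unit, Finset.mul_sum]
          exact Finset.sum_congr rfl (fun a _ => by ring)
    _ = ∑ a : ZMod N, f a * ∑ χ : DirichletCharacter ℂ N, χ ((b : ZMod N)⁻¹) * χ a := by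
          rw [Finset.sum_comm]
          exact Finset.sum_congr rfl (fun a _ => by rw [Finset.mul_sum])
    _ = ∑ a : ZMod N, f a * (if (b : ZMod N) = a then (N.totient : ℂ) else 0) := by
          refine Finset.sum_congr rfl (fun a _ => ?_)
          rw [DirichletCharacter.sum_char_inv_mul_char_eq ℂ hb a]
    _ = (N.totient : ℂ) * f b := by
          simp only [mul_ite, mul_zero]
          rw [Finset.sum_ite_eq]
          simp [mul_comm]

/-- `‖ŵ(χ)‖ ≤ Σ_a ‖f a‖`. -/
lemma norm_hat_le (χ : DirichletCharacter ℂ N) : ‖hat f χ‖ ≤ ∑ a : ZMod N, ‖f a‖ := by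
  unfold hat
  refine (norm_sum_le _ _).trans (Finset.sum_le_sum (fun a _ => ?_))
  rw [norm_mul]
  calc ‖f a‖ * ‖χ a‖ ≤ ‖f a‖ * 1 := by
        exact mul_le_mul_of_nonneg_left (DirichletCharacter.norm_le_one χ a) (norm_nonneg _)
    _ = ‖f a‖ := mul_one _

/-- The pointwise bound `φ(N) ‖f b‖ ≤ #bad · Σ_a ‖f a‖`. -/
lemma pointwise_bound (hunit : ∀ a, ¬ IsUnit a → f a = 0) (hodd : ∀ a, f (-a) = - f a)
    (htr : ∀ u : (ZMod N)ˣ, ∑ a : ZMod N, f a * ((((u : ZMod N) * a).val : ℕ) : ℂ) = 0)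
    (b : ZMod N) :
    (N.totient : ℝ) * ‖f b‖ ≤ ((badSet N).card : ℝ) * ∑ a : ZMod N, ‖f a‖ := by
  have hL : 0 ≤ ∑ a : ZMod N, ‖f a‖ := Finset.sum_nonneg (fun a _ => norm_nonneg _)
  by_cases hb : IsUnit b
  · obtain ⟨b', rfl⟩ := hb
    have h1 : (N.totient : ℝ) * ‖f b'‖ =
        ‖∑ χ : DirichletCharacter ℂ N, χ ((b'⁻¹ : (ZMod N)ˣ) : ZMod N) * hat f χ‖ := by
      rw [inversion, norm_mul]
      simp
    have h2 : ∑ χ : DirichletCharacter ℂ N, χ ((b'⁻¹ : (ZMod N)ˣ) : ZMod N) * hat f χ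
        = ∑ χ ∈ badSet N, χ ((b'⁻¹ : (ZMod N)ˣ) : ZMod N) * hat f χ := by
      symm
      apply Finset.sum_subset (Finset.subset_univ _)
      intro χ _ hχ
      rw [hat_eq_zero_of_not_bad f hunit hodd htr χ hχ, mul_zero]
    rw [h1, h2]
    refine (norm_sum_le _ _).trans ?_
    calc ∑ χ ∈ badSet N, ‖χ ((b'⁻¹ : (ZMod N)ˣ) : ZMod N) * hat f χ‖
        ≤ ∑ χ ∈ badSet N, (∑ a : ZMod N, ‖f a‖) := by
          refine Finset.sum_le_sum (fun χ _ => ?_)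
          rw [norm_mul]
          calc ‖χ ((b'⁻¹ : (ZMod N)ˣ) : ZMod N)‖ * ‖hat f χ‖ ≤ 1 * ∑ a : ZMod N, ‖f a‖ :=
                mul_le_mul (DirichletCharacter.norm_le_one χ _) (norm_hat_le f χ) (norm_nonneg _) zero_le_one
            _ = ∑ a : ZMod N, ‖f a‖ := one_mul _
      _ = ((badSet N).card : ℝ) * ∑ a : ZMod N, ‖f a‖ := by
          rw [Finset.sum_const, nsmul_eq_mul]
  · rw [hunit b hb, norm_zero, mul_zero]
    exact mul_nonneg (Nat.cast_nonneg _) hL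

/-- The uncertainty-principle step: an odd weight on the units with at most 12-point support and vanishing
residue transform is zero as soon as `12 · #bad < φ(N)`. -/
theorem core (hunit : ∀ a, ¬ IsUnit a → f a = 0) (hodd : ∀ a, f (-a) = - f a)
    (hsupp : (Finset.univ.filter (fun a => f a ≠ 0)).card ≤ 12)
    (htr : ∀ u : (ZMod N)ˣ, ∑ a : ZMod N, f a * ((((u : ZMod N) * a).val : ℕ) : ℂ) = 0)
    (hbad : 12 * (badSet N).card < N.totient) : ∀ a, f a = 0 := by
  set L : ℝ := ∑ a : ZMod N, ‖f a‖ with hLdef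
  have hL : 0 ≤ L := Finset.sum_nonneg (fun a _ => norm_nonneg _)
  -- φ · L ≤ #supp · #bad · L ≤ 12 · #bad · L
  have hsum : L = ∑ a ∈ Finset.univ.filter (fun a => f a ≠ 0), ‖f a‖ := by
    rw [hLdef, Finset.sum_filter_of_ne]
    intro a _ ha
    exact norm_ne_zero_iff.mp ha
  have key : (N.totient : ℝ) * L ≤ 12 * ((badSet N).card : ℝ) * L := by
    calc (N.totient : ℝ) * L
        = ∑ a ∈ Finset.univ.filter (fun a => f a ≠ 0), (N.totient : ℝ) * ‖f a‖ := by
          rw [hsum, Finset.mul_sum]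
      _ ≤ ∑ a ∈ Finset.univ.filter (fun a => f a ≠ 0), ((badSet N).card : ℝ) * L :=
          Finset.sum_le_sum (fun a _ => pointwise_bound f hunit hodd htr a)
      _ = ((Finset.univ.filter (fun a => f a ≠ 0)).card : ℝ) * (((badSet N).card : ℝ) * L) := by
          rw [Finset.sum_const, nsmul_eq_mul]
      _ ≤ 12 * (((badSet N).card : ℝ) * L) := by
          refine mul_le_mul_of_nonneg_right ?_ (mul_nonneg (Nat.cast_nonneg _) hL)
          exact_mod_cast hsupp
      _ = 12 * ((badSet N).card : ℝ) * L := by ring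
  have hbad' : (12 : ℝ) * ((badSet N).card : ℝ) < (N.totient : ℝ) := by exact_mod_cast hbad
  have hL0 : L = 0 := by
    by_contra hne
    have hpos : 0 < L := lt_of_le_of_ne hL (Ne.symm hne)
    have := lt_of_lt_of_le (mul_lt_mul_of_pos_right hbad' hpos) key
    exact lt_irrefl _ this
  have hall : ∀ a ∈ (Finset.univ : Finset (ZMod N)), ‖f a‖ = 0 :=
    (Finset.sum_eq_zero_iff_of_nonneg (fun a _ => norm_nonneg _)).mp (by rw [← hLdef]; exact hL0)
  intro a
  exact norm_eq_zero.mp (hall a (Finset.mem_univ a))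

end core

/-! ## 3. From `ℕ`-indexed weights to `ZMod N` and back: LEMMA W from HYPOTHESIS B -/

/-- a sum over `range N` as a sum over `ZMod N` -/
lemma sum_range_eq_sum_zmod {M : Type*} [AddCommMonoid M] (N : ℕ) [NeZero N] (g : ℕ → M) :
    ∑ x ∈ range N, g x = ∑ a : ZMod N, g a.val := by
  cases N with
  | zero => exact absurd rfl (NeZero.ne 0)
  | succ n => exact (Fin.sum_univ_eq_sum_range g (n + 1)).symm

/-- LEMMA W at level `N > 1` follows from `12 · #bad(N) < φ(N)`. -/
theorem lemmaW_of_badCount {N : ℕ} (hN : 1 < N) (hbad : 12 * badCount N < N.totient) : LemmaW N := by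
  haveI : NeZero N := ⟨by omega⟩
  intro w hw1 hw2 hw3 hw4 hw5 x
  set f : ZMod N → ℂ := fun a => ((w a.val : ℤ) : ℂ) with hf
  have w0 : w 0 = 0 := hw2 0 (by
    intro h
    have := Nat.coprime_zero_left N |>.mp h
    omega)
  have hunit : ∀ a, ¬ IsUnit a → f a = 0 := by
    intro a ha
    have hc : ¬ Nat.Coprime a.val N := by
      intro hc
      apply ha
      rw [← ZMod.natCast_zmod_val a]
      exact (ZMod.isUnit_iff_coprime a.val N).mpr hc
    simp [hf, hw2 _ hc]
  have hodd : ∀ a, f (-a) = - f a := by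
    intro a
    by_cases ha : a = 0
    · subst ha; simp [hf, w0]
    · have hv : (-a).val = N - a.val := by rw [ZMod.neg_val, if_neg ha]
      have hpos : 0 < a.val := Nat.pos_of_ne_zero (fun h => ha ((ZMod.val_eq_zero a).mp h))
      simp only [hf, hv]
      rw [hw3 _ hpos (ZMod.val_lt a)]
      push_cast; ring
  have hsupp : (Finset.univ.filter (fun a => f a ≠ 0)).card ≤ 12 := by
    refine le_trans ?_ hw4
    refine Finset.card_le_card_of_injOn (fun a => a.val) (fun a ha => ?_) ?_
    · have ha' : f a ≠ 0 := (Finset.mem_filter.mp (Finset.mem_coe.mp ha)).2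
      refine Finset.mem_coe.mpr (Finset.mem_filter.mpr ⟨Finset.mem_range.mpr (ZMod.val_lt a), ?_⟩)
      intro h0; apply ha'; simp [hf, h0]
    · intro a _ b _ h
      exact ZMod.val_injective N h
  have htr : ∀ u : (ZMod N)ˣ, ∑ a : ZMod N, f a * ((((u : ZMod N) * a).val : ℕ) : ℂ) = 0 := by
    intro u
    have h := hw5 (u : ZMod N).val (ZMod.val_coe_unit_coprime u)
    unfold resTransform at h
    rw [sum_range_eq_sum_zmod N] at h
    have h' := congrArg (Int.cast : ℤ → ℂ) h
    simp only [Int.cast_sum, Int.cast_mul, Int.cast_natCast, Int.cast_zero] at h'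
    rw [← h']
    refine Finset.sum_congr rfl (fun a _ => ?_)
    simp only [hf, ZMod.val_mul]
  have hbad2 : 12 * (badSet N).card < N.totient := by rwa [badCount_eq] at hbad
  have hz := core f hunit hodd hsupp htr hbad2
  by_cases hx : x < N
  · have h1 := hz (x : ZMod N)
    simp only [hf, ZMod.val_natCast, Nat.mod_eq_of_lt hx, Int.cast_eq_zero] at h1
    exact h1
  · exact hw1 x (by omega)

/-- LEMMA W (`HypW`) from HYPOTHESIS B -/
theorem hypW_of_B (hB : HypB) : HypW := fun N h1 hsq h2 h3 =>
  lemmaW_of_badCount h1 (hB N h1 hsq h2 h3)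

end HodgeFermat.KRFree.LemmaWFourier

/-! ## 4. THEOREM U and THEOREM D6 from HYPOTHESIS B -/

namespace HodgeFermat.KRFree.LemmaWFourier

open HodgeFermat.KRFree.TheoremD6 HodgeFermat.KRFree.TheoremU

/-- THEOREM U at the squarefree levels prime to 6, from HYPOTHESIS B. -/
theorem thmU_of_B (hB : HypB) : ThmU := thmU_of_W (hypW_of_B hB)

/-- THEOREM D6 — no disjoint coincidence of CM types at a squarefree level prime to 6 — from HYPOTHESIS B alone. -/
theorem theoremD6_of_B (hB : HypB) : D6 := theoremD6_of_W (hypW_of_B hB)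

end HodgeFermat.KRFree.LemmaWFourier
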